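import Literature.AnabelianGeometry.SemiGraphs.TemperedSpecialFibreTowerPiDataInduces
import Literature.AnabelianGeometry.SemiGraphs.TemperedDecompositionSingleVertex
import Literature.AnabelianGeometry.SemiGraphs.SpecialFibreTowerOfCharLevels
import HarnessLib

/-!
# `SpecialFibreTower.PiData` with a PROPER base admissible quotient — non-vacuity builder, and the two extras
# `ActGraphInduces`, `⊤ ∈ decompSubgroups ℍ` at the one-vertex base ([SemiAnbd] Ex. 3.10 pp. 44–45; [IUTchI] §2 pp. 44–50)

Mochizuki, *Semi-graphs of anabelioids*, Publ. RIMS **42** (2006), §3, Example 3.10, manuscript p. 44 ("`Δ ↠ π₁^temp(𝒢)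
≅ π₁^temp(𝒢^c)` … the natural quotient"; "an exhaustive sequence of open characteristic … subgroups … `N_i` … `𝒢_i`,
`𝒢^c_i`") [cite: MochizukiSemiAnbd2006, Ex 3.10 p.44]; S. Mochizuki, *Inter-universal Teichmüller theory I*, §2 p. 47
("the natural action of `G_k` on `𝔾`"), Cor. 2.3 (iii) proof pp. 48–49 [cite: Mochizuki2012, Cor 2.3 pp.47-49] (D-0012 claim
key; nothing of the series is asserted here) — the ORIGIN-DATA records `SpecialFibreTower.PiData X d S T` /
`FiniteLevels` (abc-iut-L3-t2, `TemperedSpecialFibreTowerPiData.lean`) and the origin datum `PiData.ActGraphInduces`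
(abc-iut-w4-d052, `TemperedSpecialFibreTowerPiDataInduces.lean`).

PROOF-ONLY non-vacuity file (abc-iut cell; seat abc-iut-w4-d052 gen 7; L5-lead RULINGS #115 (1) row
«NV-PROPER-ADMISSIBLE-PIDATA-WITNESS»; no definition, no instance, no new `Prop` fact).  WHY: every `PiData`-inhabited datum
of record (abc-iut-L3-t2's `PiData.nonempty_of_charLevels` and its instances, abc-iut-f-193's cusped free-profinite witness)
has BASE admissible quotient the IDENTITY (`Ker(S.admissible) = 1`), so the (H′)-route binder «`Ker(S.admissible) ≠ 1`» of
[IUTchI] Cor. 2.3 (iii)/(iv) (`TemperedCoveringsCor23KerLevelOfAdmissibleKernel.lean`, p491651) is FALSE at all of them.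
THIS FILE is abc-iut-L3-t2's 25-field builder with ONE change and TWO extras:

* `SpecialFibreTower.PiData.nonempty_of_charLevels_of_quotient` — for a §6 datum `X`, `d` with profinite infinite `Δ^temp`
  carrying a characteristic cofinal level family `N`, AND a continuous surjection `π : Δ^temp ↠ Q` onto a slim infinite
  second-countable profinite group `Q` whose kernel is normal in `Π^temp`: special-fibre data `S` with BASE fibre the
  one-vertex semi-graph of anabelioids `B(Q)` (abc-iut-L3-t2's `OneVertex.graph`/`OneVertex.chart`) and
  `S.admissible := π` (so `Ker π ≠ 1 ⇒ Ker(S.admissible) ≠ 1`), the tower with levels `N_i`, one-vertex fibres `B(N_i)`,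
  admissible kernels `1` (unchanged), `FiniteLevels`, and `P : PiData X d S T` with trivial graph actions, identity
  projections, `ℍ :=` the single vertex, `Π^tp_ℍ := ⊤` — AND: **`P.ActGraphInduces`** PROVED (the base-identity morphism of
  `B(Q)` with vertex constituent `θ_g := S.autHom g` induces `θ_g` on the chart: `F_g^* ⋙ (S ↦ S_v) = (S ↦ S_v) ⋙ B^temp(θ_g)`
  definitionally (`covPullback_oneVertexHom_comp_restrictV`), so `extend ⋙ F_g^* ⋙ restrict ≅ B^temp(θ_g)` by identity
  components; no inner-ness of `θ_g` is needed) and **`⊤ ∈ S.chart.decompSubgroups P.H`** (`⊤` is verticial at the vertex,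
  `OneVertex.top_mem_verticialSubgroups`, and verticial ⊆ decomposition subgroups of `{v}`,
  `verticialSubgroups_subset_decompSubgroups_singleVertex`).

Consumer: `StableCurveTemperedDataOfSpecialFibreQuotientPiDataNV.lean` (the witness at `Δ^temp ≅ F̂₂`, `Q :=` its maximal
pro-`3` quotient).  HONEST LIMITS: consistency evidence for the field set only — `Π^temp` of the eventual witness is a product
and profinite, the fibres are one-vertex, the graph actions trivial, the base admissible quotient is NOT the admissible
quotient of a curve; nothing of the papers is asserted; no side is taken on [IUTchIII] Cor. 3.12.
-/

noncomputable section

namespace Literature.AnabelianGeometry.SemiGraphs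

open Literature.AlgebraicGeometry.Frobenioids (IsSlimGroup)
open ProfiniteSemiGraph Topology Filter CategoryTheory

universe u

/-! ### Small group-theoretic facts (private; as in abc-iut-L3-t2's builder) -/

/-- Open subgroups of slim groups are slim. [cite: MochizukiSemiAnbd2006, §0 p.6] -/
private theorem isSlimGroup_subgroup_q {G : Type u} [Group G] [TopologicalSpace G] [ContinuousMul G]
    (hG : IsSlimGroup G) (H : Subgroup G) (hH : IsOpen (H : Set G)) : IsSlimGroup H := by
  refine ⟨fun U hU => ?_⟩
  have hUo : IsOpen ((U.map H.subtype : Subgroup G) : Set G) := by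
    have : ((U.map H.subtype : Subgroup G) : Set G) = Subtype.val '' (U : Set H) := by
      ext x; simp
    rw [this]
    exact hH.isOpenMap_subtype_val _ hU
  have hc := hG.centralizer_eq_bot _ hUo
  refine (Subgroup.eq_bot_iff_forall _).mpr fun c hc' => ?_
  have hcG : (c : G) ∈ Subgroup.centralizer ((U.map H.subtype : Subgroup G) : Set G) := by
    rw [Subgroup.mem_centralizer_iff]
    rintro _ ⟨u, hu, rfl⟩
    exact congrArg Subtype.val (Subgroup.mem_centralizer_iff.mp hc' u hu)
  rw [hc] at hcG
  exact Subtype.ext (Subgroup.mem_bot.mp hcG)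

/-- A subgroup of finite index of an infinite group is infinite. [folklore] -/
private theorem infinite_of_finiteIndex_q {G : Type u} [Group G] [Infinite G] (H : Subgroup G) [H.FiniteIndex] :
    Infinite H := by
  by_contra hfin
  rw [not_infinite_iff_finite] at hfin
  have hcard : Nat.card G = H.index * Nat.card H := (Subgroup.index_mul_card H).symm
  have hne : Nat.card G ≠ 0 := by
    rw [hcard]
    exact mul_ne_zero Subgroup.FiniteIndex.index_ne_zero (Nat.card_pos (α := H)).ne'
  haveI := Nat.finite_of_card_ne_zero hne
  exact not_finite G

/-- An open subgroup of a compact group is compact. [folklore] -/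
private theorem compactSpace_subgroup_q {G : Type u} [Group G] [TopologicalSpace G] [ContinuousMul G]
    [CompactSpace G] (H : Subgroup G) (hH : IsOpen (H : Set G)) : CompactSpace H :=
  isCompact_iff_compactSpace.mp (H.isClosed_of_isOpen hH).isCompact

/-- In a profinite group a family cofinal among the open NORMAL subgroups of finite index is exhaustive.
[cite: MochizukiSemiAnbd2006, Ex 3.10 p.44] -/
private theorem eq_one_of_forall_mem_of_cofinal_normal_q {Δ : Type u} [Group Δ] [TopologicalSpace Δ]
    [IsTopologicalGroup Δ] [CompactSpace Δ] [TotallyDisconnectedSpace Δ] (N : ℕ → Subgroup Δ)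
    (hcof : ∀ U : Subgroup Δ, IsOpen (U : Set Δ) → U.Normal → U.FiniteIndex → ∃ i, N i ≤ U) (g : Δ)
    (hg : ∀ i, g ∈ N i) : g = 1 := by
  by_contra hne
  obtain ⟨H, hH⟩ := ProfiniteGrp.exist_openNormalSubgroup_sub_open_nhds_of_one
    (isOpen_compl_singleton (x := g)) (by simpa using fun h : (1 : Δ) = g => hne h.symm)
  haveI : Finite (Δ ⧸ H.toSubgroup) := Subgroup.quotient_finite_of_isOpen _ H.isOpen
  haveI : H.toSubgroup.FiniteIndex := Subgroup.finiteIndex_of_finite_quotient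
  obtain ⟨i, hi⟩ := hcof H.toSubgroup H.isOpen inferInstance inferInstance
  exact hH (hi (hg i)) rfl

/-! ### A one-vertex self-morphism with a prescribed vertex constituent -/

namespace ProfiniteSemiGraph.OneVertex

variable {Q : Type u} [Group Q] [TopologicalSpace Q] [IsTopologicalGroup Q] [CompactSpace Q]
  [TotallyDisconnectedSpace Q]

/-- For the one-vertex edgeless graph on `Q`, pulling back along the base-identity morphism with vertex constituent `θ`
and restricting to the vertex IS restriction followed by `B^temp(θ)` (definitional, `covPullback_comp_restrictV`).
[cite: MochizukiSemiAnbd2006, Prop 3.6(iv) p.39] -/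
theorem covPullback_oneVertexHom_comp_restrictV (θ : Q →ₜ* Q) :
    (({ base := 𝟙 (graph Q).graph, hV := fun _ => θ, hE := fun e => PEmpty.elim e,
         comm := fun b => PEmpty.elim b } :
        Hom (graph Q) (graph Q))).covPullback ⋙ restrictV (graph Q) PUnit.unit =
      restrictV (graph Q) PUnit.unit ⋙ BTemp.res θ :=
  rfl

end ProfiniteSemiGraph.OneVertex

/-! ### The builder -/

namespace SpecialFibreTower

variable {p : ℕ} [Fact p.Prime]

/-- **NON-VACUITY of `SpecialFibreTower.PiData` WITH A PROPER BASE ADMISSIBLE QUOTIENT** ([SemiAnbd] Ex. 3.10 pp. 44–45 /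
[IUTchI] §2 as typed in `TemperedSpecialFibreTowerPiData.lean`; abc-iut-L3-t2's `PiData.nonempty_of_charLevels` with ONE
change): for a §6 datum `X : TemperedCurve p`, `d : X.GroupLevelData` with profinite infinite `Δ^temp` carrying an antitone
family `N` of open normal finite-index subgroups stable under all automorphisms of the topological group `Δ^temp` and cofinal
among the open normal subgroups of finite index, AND a continuous surjection `π : Δ^temp ↠ Q` onto a slim infinite second
countable profinite group `Q` whose kernel is normal in `Π^temp`, there are special-fibre data `S` with BASE fibre the
one-vertex semi-graph of anabelioids `B(Q)` and admissible quotient `π` (so `Ker(S.admissible) ≠ 1` as soon as `Ker π ≠ 1`),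
and a tower `T` with levels `N` (fibres `B(N_i)`, charts `π₁^temp = N_i`, admissible kernels `1`), such that
`FiniteLevels X d S T` holds and `PiData X d S T` is INHABITED by a `P` with, MOREOVER, **`P.ActGraphInduces`** (the base
graph actions are trivial; `F_g :=` the base-identity morphism with vertex constituent `S.autHom g`) and
**`⊤ ∈ S.chart.decompSubgroups P.H`** (`P.H :=` the single vertex).  Consistency evidence for the field set only; not the tower
of a curve. [cite: MochizukiSemiAnbd2006, Ex 3.10 p.44] -/
theorem PiData.nonempty_of_charLevels_of_quotient (X : TemperedCurve p) (d : X.GroupLevelData)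
    (hΔcpt : CompactSpace X.DeltaTemp) (hΔtd : TotallyDisconnectedSpace X.DeltaTemp) (hinf : Infinite X.DeltaTemp)
    (N : ℕ → Subgroup X.DeltaTemp) (hanti : Antitone N) (hopen : ∀ i, IsOpen (N i : Set X.DeltaTemp))
    (hchar : ∀ (i) (φ : X.DeltaTemp ≃ₜ* X.DeltaTemp), (N i).map φ.toMulEquiv.toMonoidHom = N i)
    (hnormal : ∀ i, (N i).Normal) (hfi : ∀ i, (N i).FiniteIndex)
    (hcof : ∀ U : Subgroup X.DeltaTemp, IsOpen (U : Set X.DeltaTemp) → U.Normal → U.FiniteIndex → ∃ i, N i ≤ U)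
    (Q : Type) [Group Q] [TopologicalSpace Q] [IsTopologicalGroup Q] [CompactSpace Q] [TotallyDisconnectedSpace Q]
    [SecondCountableTopology Q] [Infinite Q] (hQslim : IsSlimGroup Q)
    (π : X.DeltaTemp →ₜ* Q) (hπ : Function.Surjective π)
    (hKn : ((π.toMonoidHom.ker).map X.DeltaTemp.subtype).Normal) :
    ∃ (S : SpecialFibreData (X.toTemperedArithmeticGroup d)) (T : SpecialFibreTower X.DeltaTemp),
      T.N = N ∧ (∀ i, T.admKer i = ⊥) ∧ (π.toMonoidHom.ker ≠ ⊥ → S.admissible.toMonoidHom.ker ≠ ⊥) ∧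
        S.Gc.Prop36Hypotheses ∧ FiniteLevels X d S T ∧
        ∃ P : PiData X d S T, P.ActGraphInduces ∧ (⊤ : Subgroup S.chart.G) ∈ S.chart.decompSubgroups P.H := by
  classical
  haveI : IsGalois ℚ_[p] (AlgebraicClosure ℚ_[p]) := {}
  haveI : T2Space (GQp p) := krullTopology_t2
  haveI : SecondCountableTopology X.PiTemp := d.secondCountableTopology
  haveI := hΔcpt
  haveI := hΔtd
  haveI hΔsc : SecondCountableTopology X.DeltaTemp := TopologicalSpace.Subtype.secondCountableTopology _
  haveI := hinf
  -- slimness of `Δ^temp` (from the parameter bundle: `Ker(augK) = Δ^temp`)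
  have hslimΔ : IsSlimGroup X.DeltaTemp := by
    have h := d.isSlimGroup_ker
    rwa [TemperedCurve.ker_augK] at h
  have hexh : ∀ g : X.DeltaTemp, (∀ i, g ∈ N i) → g = 1 := eq_one_of_forall_mem_of_cofinal_normal_q N hcof
  -- the levels as profinite groups with level families
  haveI hcpt : ∀ i : ℕ, CompactSpace (N i) := fun i => compactSpace_subgroup_q (N i) (hopen i)
  haveI hsc : ∀ i : ℕ, SecondCountableTopology (N i) :=
    fun i => TopologicalSpace.Subtype.secondCountableTopology _
  haveI hinfN : ∀ i : ℕ, Infinite (N i) := fun i => infinite_of_finiteIndex_q (N i)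
  have hslimN : ∀ i : ℕ, IsSlimGroup (N i) := fun i => isSlimGroup_subgroup_q hslimΔ (N i) (hopen i)
  have L : ∀ i : ℕ, ProfiniteSemiGraph.LevelFamily (N i) :=
    fun i => Classical.choice (ProfiniteSemiGraph.LevelFamily.nonempty_of_infinite (N i))
  -- a level family of the base group `Q`
  have L₀ : ProfiniteSemiGraph.LevelFamily Q :=
    Classical.choice (ProfiniteSemiGraph.LevelFamily.nonempty_of_infinite Q)
  -- the group-level datum `D` and its `Δ = Ker(augK)`, equal to `Δ^temp`
  let D := X.toTemperedArithmeticGroup d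
  have hδ : D.delta = X.DeltaTemp := X.toTemperedArithmeticGroup_delta d
  -- the admissible quotient of the base: `Δ ⥲ Δ^temp ↠ Q`
  let incl₀ : D.delta →ₜ* X.DeltaTemp :=
    { toMonoidHom := Subgroup.inclusion hδ.le
      continuous_toFun := continuous_inclusion hδ.le }
  let adm₀ : D.delta →ₜ* Q := π.comp incl₀
  have hincl₀_surj : Function.Surjective incl₀ := fun y => ⟨⟨y.1, hδ.ge y.2⟩, rfl⟩
  have hadm₀_surj : Function.Surjective adm₀ := hπ.comp hincl₀_surj
  -- the special-fibre data of the base: `𝒢^c := B(Q)`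
  let S : SpecialFibreData D :=
    { Gc := OneVertex.graph Q
      hyp := OneVertex.thm37Hypotheses L₀ hQslim
      chart := OneVertex.chart L₀
      admissible := adm₀
      admissible_surjective := hadm₀_surj }
  -- the kernel of the base admissible quotient, read in `Π^temp`, is the kernel of `π` read in `Π^temp`
  have hkerS : S.admissible.toMonoidHom.ker.map D.delta.subtype = π.toMonoidHom.ker.map X.DeltaTemp.subtype := by
    ext x
    constructor
    · rintro ⟨y, hy, rfl⟩
      exact ⟨incl₀ y, hy, rfl⟩
    · rintro ⟨y, hy, rfl⟩
      exact ⟨⟨y.1, hδ.ge y.2⟩, hy, rfl⟩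
  -- the tower: levels `N_i`, fibres `B(N_i)`, admissible kernels `1`
  let T : SpecialFibreTower X.DeltaTemp :=
    { N := N
      N_antitone := hanti
      isOpen_N := hopen
      N_char := hchar
      N_normal := hnormal
      N_finiteIndex := hfi
      N_exhaustive := hexh
      Gc := fun i => OneVertex.graph (N i)
      hyp := fun i => OneVertex.thm37Hypotheses (L i) (hslimN i)
      chart := fun i => OneVertex.chart (L i)
      admKer := fun _ => ⊥
      admKer_le := fun _ => bot_le
      admKer_normal := fun _ => inferInstance
      admKer_antitone := fun _ _ _ => le_rfl
      adm := fun i => ContinuousMonoidHom.id _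
      adm_surjective := fun i => Function.surjective_id
      isOpenMap_adm := fun i => IsOpenMap.id
      ker_adm := fun i => by
        rw [Subgroup.bot_subgroupOf]
        exact (MonoidHom.ker_eq_bot_iff _).mpr Function.injective_id
      faithful := fun i g hg => by
        have hz : g ∈ Subgroup.centralizer (N i : Set X.DeltaTemp) := by
          rw [Subgroup.mem_centralizer_iff]
          intro n hn
          have h := hg n hn
          rw [Subgroup.mem_bot] at h
          have : g * n = n * g := by
            calc g * n = g * n * g⁻¹ * n⁻¹ * (n * g) := by group
              _ = n * g := by rw [h, one_mul]
          exact this.symm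
        rw [hslimΔ.centralizer_eq_bot _ (hopen i), Subgroup.mem_bot] at hz
        rw [hz]; exact (N i).one_mem }
  -- finiteness of the (one-vertex, edgeless) fibres
  have hF : FiniteLevels X d S T :=
    { finite_vertex_base := by show Finite PUnit; infer_instance
      finite_edge_base := by show Finite PEmpty; infer_instance
      finite_vertex := fun i => by show Finite PUnit; infer_instance
      finite_edge := fun i => by show Finite PEmpty; infer_instance }
  -- one-vertex fibres: the vertex types are `PUnit`
  have hsubT : ∀ i, Subsingleton (T.Gc i).graph.Vertex := fun _ => (inferInstance : Subsingleton PUnit)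
  have hsubS : Subsingleton S.Gc.graph.Vertex := (inferInstance : Subsingleton PUnit)
  -- the sub-semi-graph `ℍ := {v}` (the single vertex, no edges) is connected
  let H : S.Gc.graph.Subgraph := ⟨{PUnit.unit}, ∅⟩
  have hsubH : Subsingleton H.toSemiGraph.Vertex :=
    ⟨fun a b => Subtype.ext (@Subsingleton.elim _ hsubS _ _)⟩
  have hHconn : H.toSemiGraph.IsConnected := by
    refine ⟨@SimpleGraph.Connected.mk _ _ ?_ ⟨Sum.inl ⟨PUnit.unit, Set.mem_singleton _⟩⟩⟩
    intro a b
    have hab : a = b := by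
      rcases a with a | a | a
      · rcases b with b | b | b
        · exact congrArg Sum.inl (@Subsingleton.elim _ hsubH _ _)
        · exact b.1.elim
        · exact b.1.elim
      · exact a.1.elim
      · exact a.1.elim
    subst hab
    exact SimpleGraph.Reachable.refl _
  have hK0 : (S.admissible.toMonoidHom.ker.map D.delta.subtype).Normal := by rw [hkerS]; exact hKn
  let P : PiData X d S T :=
    { admKer_normal_pi := fun i => by
        show ((⊥ : Subgroup X.DeltaTemp).map X.DeltaTemp.subtype).Normal
        rw [Subgroup.map_bot]; infer_instance
      admissibleKer_normal_pi := hK0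
      N_cofinal := hcof
      finite := hF
      actGraph := fun _ => 1
      actGraph₀ := 1
      actGraph_vertexMap := fun i _ _ _ => @Subsingleton.elim _ (hsubT i) _ _
      actGraph₀_vertexMap := fun _ _ _ => @Subsingleton.elim _ hsubS _ _
      proj := fun _ => 𝟙 _
      proj_vertex_surjective := fun _ => Function.surjective_id
      proj_actGraph := fun _ _ => rfl
      H := H
      H_connected := hHconn
      H_stable := fun _ => ⟨fun _ hv => hv, fun _ he => he⟩
      TpH := ⊤
      TpH_verticial := fun v _ => ⟨⊤, OneVertex.top_mem_verticialSubgroups L₀ v, le_rfl⟩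
      TpH_le := by
        intro x _
        apply Subgroup.le_topologicalClosure
        apply Subgroup.subset_closure
        refine Set.mem_iUnion₂.mpr ⟨PUnit.unit, Set.mem_singleton _, ?_⟩
        exact Set.mem_iUnion₂.mpr ⟨⊤, OneVertex.top_mem_verticialSubgroups L₀ _, Subgroup.mem_top x⟩
      baseVertex := PUnit.unit
      baseVertex_mem := Set.mem_singleton _
      baseLift := fun _ => PUnit.unit
      proj_baseLift := fun _ => rfl
      vtxOfCusp := fun _ _ => PUnit.unit
      proj_vtxOfCusp := fun _ _ _ => rfl
      inertia_le_verticial := fun i x =>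
        ⟨⊤, OneVertex.top_mem_verticialSubgroups (L i) _, le_top⟩ }
  refine ⟨S, T, rfl, fun _ => rfl, ?_, S.hyp.toProp36Hypotheses, hF, ⟨P, ?_, ?_⟩⟩
  · -- `Ker π ≠ 1 ⇒ Ker(S.admissible) ≠ 1`
    intro hKπ hbot
    apply hKπ
    rw [eq_bot_iff]
    intro y hy
    obtain ⟨z, rfl⟩ := hincl₀_surj y
    have hz : z ∈ S.admissible.toMonoidHom.ker := hy
    rw [hbot, Subgroup.mem_bot] at hz
    rw [hz, map_one]
    exact Subgroup.one_mem _
  · -- `ActGraphInduces`: the base-identity morphism with vertex constituent `autHom g` induces `autHom g`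
    intro g
    let θ : S.chart.G →ₜ* S.chart.G := ⟨S.autHom P.admissibleKer_normal_pi g, S.continuous_autHom P.admissibleKer_normal_pi g⟩
    let F : Hom S.Gc S.Gc :=
      { base := 𝟙 S.Gc.graph, hV := fun _ => θ, hE := fun e => PEmpty.elim e, comm := fun b => PEmpty.elim b }
    have hθbij : Function.Bijective θ := by
      refine Function.bijective_iff_has_inverse.mpr ⟨S.autHom P.admissibleKer_normal_pi g⁻¹, fun x => ?_, fun x => ?_⟩
      · show S.autHom P.admissibleKer_normal_pi g⁻¹ (S.autHom P.admissibleKer_normal_pi g x) = x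
        rw [← S.autHom_mul, inv_mul_cancel, S.autHom_one]
      · show S.autHom P.admissibleKer_normal_pi g (S.autHom P.admissibleKer_normal_pi g⁻¹ x) = x
        rw [← S.autHom_mul, mul_inv_cancel, S.autHom_one]
    refine ⟨F, ⟨fun _ => hθbij, fun e => PEmpty.elim e⟩, rfl, ⟨?_⟩⟩
    -- `extend ⋙ F^* ⋙ restrict ≅ B^temp(θ)` by identity components
    refine NatIso.ofComponents (fun Y => Iso.refl _) ?_
    intro Y Z f
    exact (Category.comp_id _).trans (Category.id_comp _).symm
  · -- `⊤ ∈ decompSubgroups {v}`: `⊤` is verticial at the vertex of `B(Q)`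
    show (⊤ : Subgroup S.chart.G) ∈ S.chart.decompSubgroups ⟨{PUnit.unit}, ∅⟩
    haveI : SecondCountableTopology (S.Gc.Gv PUnit.unit) := inferInstanceAs (SecondCountableTopology Q)
    exact ProfiniteSemiGraph.TemperedPiChart.verticialSubgroups_subset_decompSubgroups_singleVertex S.chart PUnit.unit
      (OneVertex.top_mem_verticialSubgroups L₀ PUnit.unit)

end SpecialFibreTower

end Literature.AnabelianGeometry.SemiGraphs

end
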